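/- Width seat `ym-line-sfw-p2-w5` (prover-ym-line-sfw-p2-w5-g19-0), free hands on planner ym-idea-2 g17's typed task T-U2.S
(`Cruxes/BoxWindowHighSU2213/TaskU2S.lean`, STUB-PLAN-U2 rev 2 §3) for LINE-20 «landau-rung3» stub U2 on ⟨stmt-QuantumFields-24336⟩. -/
import Summits.QuantumFields.YangMills.Theorems.AllWindowsColdBoxBoxHighLineLandauBallQuaternion
import Summits.QuantumFields.YangMills.Theorems.CovariantDischargeUniformFluxLetters
import Summits.QuantumFields.YangMills.Theorems.QuantileBitPuritySU2ClassShiftAxisLipschitz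
import Summits.QuantumFields.YangMills.Theorems.WeakCouplingRatesColdBoxLinkSmall
import Literature.MathematicalPhysics.QuantumFieldTheory.Balaban1983to89.T4WilsonLinkAffine
import Mathlib.Analysis.SpecialFunctions.Trigonometric.Bounds

/-!
# T-U2.S («uniformised temporal gauge»), part 1: principal roots in `SU(2)` and the quaternion length function

Toolkit for the sharp Stage I bound `UniformGaugeBound` / `SharpStageI` of LINE-20 U2 (planner ym-idea-2 g17, STUB-PLAN-U2 rev 2 §3.3): the
column holonomies of the temporal forest gauge are redistributed evenly over the `2H` temporal links of their column, which needs the PRINCIPAL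
`m`-TH ROOT `kroot m h = exp(ι(logVec(q_h)/m))` in `SU(2)` (tree chart `T4HaarSU2ExpChart.expPoint`, tree logarithm `T4ExpWindowSmallField.logVec`)
with: `kroot_pow` (`(kroot m h)^m = h`); `norm_kroot_sub_one_le` (`ℓ(kroot m h) ≤ (π/2)·ℓ(h)/m`); `norm_kroot_sub_kroot_le` (**the root is
`18/m`-Lipschitz on `Re q ≥ 0`**, from `v ↦ exp(ι v)` 3-Lipschitz and `logVec` 6-Lipschitz on the half-ball — elementary «same axis / same angle»
legs, Jordan's inequality `Real.mul_le_sin`, the tree's `ClassShift.norm_normalize_sub_normalize_le`); telescoping `norm_su2Quat_pow_sub_pow_le`;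
sandwich `norm_mul_mul_star_sub_one_le`; and the quaternion length `ellq U = ‖su2Quat U − 1‖` with `ellq_one/_mul_le/_inv/_conj`,
`norm_su2Quat_sub_eq_ellq`, `ellq_eq_opDist1`, `ellq_sq_eq_linkDefect` — the hypotheses of the tree's abstract forest Poincaré ladder
`WeakCouplingRates.ell_spatial` & co.  Everything proved, Mathlib + tree only; two explicit-function definitions (`kroot`, `ellq`; no `Prop`);
standard axioms.  HONEST LABEL: helper toward the typed task T-U2.S of an OPEN stub (U2) of a critic-PASSed DRAFT-by-design line on the R2ξ″
RECORD-rung crux ⟨24336⟩; no stub is proved by name, no crux, rung or summit is proved; the Yang–Mills mass gap is NOT proved by this file.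
-/
set_option autoImplicit false

noncomputable section

open scoped Real Quaternion
open NormedSpace
open Literature.MathematicalPhysics.QuantumLattice (su2Quat quatToSU2 quatToSU2_su2Quat norm_su2Quat su2Quat_ne_zero fundamentalRep)
open Literature.MathematicalPhysics.QuantumFieldTheory (su2Deficit_eq_norm_sub_sq)
open Literature.MathematicalPhysics.QuantumFieldTheory.Balaban1983to89
open Literature.MathematicalPhysics.QuantumFieldTheory.Balaban1983to89.UnitaryModel (opDist1 opDist1_nonneg)
open T4HaarSU2ExpChart (imQuat imQuat_apply imQuat_re norm_imQuat exp_imQuat_smul norm_exp_imQuat expPoint su2Quat_expPoint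
  expPoint_zero)
open T4HaarSU2Translate (su2Quat_mul su2Quat_one)
open T4QuatExpLog (norm_exp_sub_one_le norm_exp_of_re_eq_zero)
open T4WilsonLinkAffine (su2Quat_inv)
open T4ExpWindowSmallField (logVec norm_logVec expPoint_logVec norm_sub_one_eq_two_mul_sin norm_sub_one_sq imVec norm_imVec_sq
  norm_imVec_sq_of_norm_eq_one neg_one_le_re re_le_one two_sub_two_mul_cos)
open Summit.QuantumFields.YangMills.Theorems.CovariantDischargeUniformFluxLetters (expPoint_add_smul expPoint_zero_smul
  commute_imQuat_smul)
open Summit.QuantumFields.YangMills.Theorems.FemtoTransferGap.ClassShift (norm_normalize_sub_normalize_le)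
open Summit.QuantumFields.YangMills.Theorems.WeakCouplingRates (opDist1_fundamentalRep_sq)

namespace Summit.QuantumFields.YangMills.Theorems.AllWindowsColdBoxBoxHighLine.UniformGauge

/-- Powers along a ray: `exp(ι (n·a) v) = exp(ι a v)^n`. -/
theorem expPoint_natMul_smul (n : ℕ) (a : ℝ) (v : EuclideanSpace ℝ (Fin 3)) : expPoint (((n : ℝ) * a) • v) = expPoint (a • v) ^ n := by
  induction n with
  | zero => rw [Nat.cast_zero, zero_mul, pow_zero, expPoint_zero_smul]
  | succ n ih => rw [Nat.cast_succ, add_mul, one_mul, expPoint_add_smul, ih, pow_succ]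

/-- **The principal `m`-th root** of `h ∈ SU(2)`: `exp(ι(logVec(q_h)/m))`, the point at parameter `1/m` on the principal ray through `h`
(junk `= 1` for `m = 0`). -/
def kroot (m : ℕ) (h : SU2) : SU2 := expPoint (((m : ℝ)⁻¹) • logVec (su2Quat h))

/-- `(kroot m h)^m = h` (`m ≠ 0`). -/
theorem kroot_pow {m : ℕ} (hm : m ≠ 0) (h : SU2) : kroot m h ^ m = h := by
  unfold kroot; rw [← expPoint_natMul_smul, mul_inv_cancel₀ (Nat.cast_ne_zero.2 hm), one_smul]; exact expPoint_logVec h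

/-- The class angle is at most `π/2` times the chord: `arccos (Re q) ≤ (π/2)·‖q − 1‖` for a unit quaternion (Jordan's inequality). -/
theorem arccos_re_le_norm_sub_one {q : ℍ} (hq : ‖q‖ = 1) : Real.arccos q.re ≤ π / 2 * ‖q - 1‖ := by
  have h := norm_sub_one_eq_two_mul_sin hq
  have h0 : 0 ≤ Real.arccos q.re / 2 := by linarith [Real.arccos_nonneg q.re]
  have h1 : Real.arccos q.re / 2 ≤ π / 2 := by linarith [Real.arccos_le_pi q.re]
  have hj := Real.mul_le_sin h0 h1
  have hπ := Real.pi_pos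
  have h2 : Real.arccos q.re / π ≤ Real.sin (Real.arccos q.re / 2) := by
    have e : 2 / π * (Real.arccos q.re / 2) = Real.arccos q.re / π := by ring
    rw [← e]; exact hj
  rw [div_le_iff₀ hπ] at h2
  calc Real.arccos q.re ≤ Real.sin (Real.arccos q.re / 2) * π := h2
    _ = π / 2 * ‖q - 1‖ := by rw [h]; ring

/-- Chord ≤ arc on a ray: `‖q(exp(ι v)) − 1‖ ≤ ‖v‖`. -/
theorem norm_su2Quat_expPoint_sub_one_le (v : EuclideanSpace ℝ (Fin 3)) : ‖su2Quat (expPoint v) - 1‖ ≤ ‖v‖ := by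
  rw [su2Quat_expPoint]; exact (norm_exp_sub_one_le (imQuat_re v)).trans (norm_imQuat v).le

/-- **The root is close to `1`**: `‖q(kroot m h) − 1‖ ≤ (π/2)·‖q_h − 1‖/m`. -/
theorem norm_kroot_sub_one_le (m : ℕ) (h : SU2) : ‖su2Quat (kroot m h) - 1‖ ≤ π / 2 * ‖su2Quat h - 1‖ / m := by
  unfold kroot
  refine (norm_su2Quat_expPoint_sub_one_le _).trans ?_
  rw [norm_smul, norm_inv, Real.norm_natCast, norm_logVec, div_eq_mul_inv, mul_comm ((m : ℝ)⁻¹)]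
  exact mul_le_mul_of_nonneg_right (arccos_re_le_norm_sub_one (norm_su2Quat h)) (inv_nonneg.2 (Nat.cast_nonneg m))

/-- Two legs in polar form: `‖exp(ι θω) − exp(ι θ'ω')‖ ≤ |θ − θ'| + θ'·‖ω − ω'‖` for unit `ω, ω'` and `θ' ≥ 0`
(same axis: a commuting one-parameter group, chord ≤ arc; same angle: `|sin θ'|·‖ω − ω'‖`). -/
theorem norm_exp_polar_sub_le {θ θ' : ℝ} (hθ' : 0 ≤ θ') {ω ω' : EuclideanSpace ℝ (Fin 3)} (hω : ‖ω‖ = 1) (hω' : ‖ω'‖ = 1) :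
    ‖exp (imQuat (θ • ω)) - exp (imQuat (θ' • ω'))‖ ≤ |θ - θ'| + θ' * ‖ω - ω'‖ := by
  letI : NormedAlgebra ℚ ℍ := NormedAlgebra.restrictScalars ℚ ℝ ℍ
  have leg1 : ‖exp (imQuat (θ • ω)) - exp (imQuat (θ' • ω))‖ ≤ |θ - θ'| := by
    have hsplit : θ • ω = θ' • ω + (θ - θ') • ω := by rw [← add_smul]; ring_nf
    have hc : Commute (imQuat (θ' • ω)) (imQuat ((θ - θ') • ω)) := commute_imQuat_smul θ' (θ - θ') ω
    rw [hsplit, map_add, exp_add_of_commute hc, ← mul_sub_one, norm_mul, norm_exp_imQuat, one_mul]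
    calc ‖exp (imQuat ((θ - θ') • ω)) - 1‖ ≤ ‖imQuat ((θ - θ') • ω)‖ := norm_exp_sub_one_le (imQuat_re _)
      _ = |θ - θ'| := by rw [norm_imQuat, norm_smul, hω, mul_one, Real.norm_eq_abs]
  have leg2 : ‖exp (imQuat (θ' • ω)) - exp (imQuat (θ' • ω'))‖ ≤ θ' * ‖ω - ω'‖ := by
    rw [exp_imQuat_smul hω, exp_imQuat_smul hω', add_sub_add_left_eq_sub, ← smul_sub, ← map_sub, norm_smul, norm_imQuat,
      Real.norm_eq_abs]
    refine mul_le_mul_of_nonneg_right ?_ (norm_nonneg _)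
    calc |Real.sin θ'| ≤ |θ'| := Real.abs_sin_le_abs
      _ = θ' := abs_of_nonneg hθ'
  calc ‖exp (imQuat (θ • ω)) - exp (imQuat (θ' • ω'))‖
      ≤ ‖exp (imQuat (θ • ω)) - exp (imQuat (θ' • ω))‖ + ‖exp (imQuat (θ' • ω)) - exp (imQuat (θ' • ω'))‖ :=
        norm_sub_le_norm_sub_add_norm_sub _ _ _
    _ ≤ |θ - θ'| + θ' * ‖ω - ω'‖ := add_le_add leg1 leg2

/-- **`v ↦ exp(ι v)` is 3-Lipschitz** from `ℝ³` to `ℍ`: `‖exp(ι u) − exp(ι u')‖ ≤ 3‖u − u'‖`. -/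
theorem norm_exp_imQuat_sub_exp_imQuat_le (u u' : EuclideanSpace ℝ (Fin 3)) : ‖exp (imQuat u) - exp (imQuat u')‖ ≤ 3 * ‖u - u'‖ := by
  by_cases hu' : u' = 0
  · subst hu'
    rw [map_zero, exp_zero, sub_zero]
    calc ‖exp (imQuat u) - 1‖ ≤ ‖imQuat u‖ := norm_exp_sub_one_le (imQuat_re u)
      _ = ‖u‖ := norm_imQuat u
      _ ≤ 3 * ‖u‖ := by linarith [norm_nonneg u]
  by_cases hu : u = 0
  · subst hu
    rw [map_zero, exp_zero, norm_sub_rev, zero_sub, norm_neg]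
    calc ‖exp (imQuat u') - 1‖ ≤ ‖imQuat u'‖ := norm_exp_sub_one_le (imQuat_re u')
      _ = ‖u'‖ := norm_imQuat u'
      _ ≤ 3 * ‖u'‖ := by linarith [norm_nonneg u']
  have hθ : 0 < ‖u‖ := norm_pos_iff.2 hu
  have hθ' : 0 < ‖u'‖ := norm_pos_iff.2 hu'
  have hω : ‖‖u‖⁻¹ • u‖ = 1 := by rw [norm_smul, norm_inv, norm_norm, inv_mul_cancel₀ hθ.ne']
  have hω' : ‖‖u'‖⁻¹ • u'‖ = 1 := by rw [norm_smul, norm_inv, norm_norm, inv_mul_cancel₀ hθ'.ne']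
  have huω : ‖u‖ • (‖u‖⁻¹ • u) = u := by rw [smul_smul, mul_inv_cancel₀ hθ.ne', one_smul]
  have hu'ω' : ‖u'‖ • (‖u'‖⁻¹ • u') = u' := by rw [smul_smul, mul_inv_cancel₀ hθ'.ne', one_smul]
  have hlegs := norm_exp_polar_sub_le (θ := ‖u‖) hθ'.le hω hω'
  rw [huω, hu'ω'] at hlegs
  have hang : |‖u‖ - ‖u'‖| ≤ ‖u - u'‖ := abs_norm_sub_norm_le u u'
  -- the axis leg: `θ'‖ω − ω'‖ = ‖θ'ω − u'‖ ≤ ‖θ'ω − θω‖ + ‖u − u'‖ ≤ 2‖u − u'‖`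
  have hax : ‖u'‖ * ‖‖u‖⁻¹ • u - ‖u'‖⁻¹ • u'‖ ≤ 2 * ‖u - u'‖ := by
    have e1 : ‖‖u'‖ • (‖u‖⁻¹ • u) - ‖u'‖ • (‖u'‖⁻¹ • u')‖ = ‖u'‖ * ‖‖u‖⁻¹ • u - ‖u'‖⁻¹ • u'‖ := by
      rw [← smul_sub, norm_smul, Real.norm_of_nonneg hθ'.le]
    have e1' : ‖‖u'‖ • (‖u‖⁻¹ • u) - ‖u'‖ • (‖u'‖⁻¹ • u')‖ = ‖‖u'‖ • (‖u‖⁻¹ • u) - u'‖ := by rw [hu'ω']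
    have e2 : ‖‖u'‖ • (‖u‖⁻¹ • u) - u'‖ ≤ ‖‖u'‖ • (‖u‖⁻¹ • u) - ‖u‖ • (‖u‖⁻¹ • u)‖ + ‖‖u‖ • (‖u‖⁻¹ • u) - u'‖ :=
      norm_sub_le_norm_sub_add_norm_sub _ _ _
    have e3 : ‖‖u'‖ • (‖u‖⁻¹ • u) - ‖u‖ • (‖u‖⁻¹ • u)‖ = |‖u'‖ - ‖u‖| := by
      rw [← sub_smul, norm_smul, hω, mul_one, Real.norm_eq_abs]
    have e5 : ‖‖u‖ • (‖u‖⁻¹ • u) - u'‖ = ‖u - u'‖ := by rw [huω]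
    have e4 : |‖u'‖ - ‖u‖| ≤ ‖u - u'‖ := by rw [abs_sub_comm]; exact hang
    linarith
  linarith

/-- `‖x‖² = re² + ‖imVec x‖²` for every quaternion. -/
theorem norm_sq_eq_re_sq_add_norm_imVec_sq (x : ℍ) : ‖x‖ ^ 2 = x.re ^ 2 + ‖imVec x‖ ^ 2 := by
  rw [norm_imVec_sq, sq, ← Quaternion.normSq_eq_norm_mul_self, Quaternion.normSq_def']
  ring

/-- `‖imVec x − imVec y‖ ≤ ‖x − y‖` (`imVec` is additive and shorter than the quaternion). -/
theorem norm_imVec_sub_le (x y : ℍ) : ‖imVec x - imVec y‖ ≤ ‖x - y‖ := by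
  have imVec_sub : imVec (x - y) = imVec x - imVec y := by ext i; fin_cases i <;> simp [imVec]
  rw [← imVec_sub]
  have h := norm_sq_eq_re_sq_add_norm_imVec_sq (x - y)
  nlinarith [norm_nonneg (imVec (x - y)), norm_nonneg (x - y), sq_nonneg (x - y).re]

/-- The angle coordinates of two unit quaternions: `(cos θ − cos θ')² + (sin θ − sin θ')² ≤ ‖q − q'‖²` with `θ = arccos (Re q)`,
`sin θ = ‖imVec q‖`. -/
theorem angle_coords_sq_le {q q' : ℍ} (hq : ‖q‖ = 1) (hq' : ‖q'‖ = 1) :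
    (Real.cos (Real.arccos q.re) - Real.cos (Real.arccos q'.re)) ^ 2 +
      (Real.sin (Real.arccos q.re) - Real.sin (Real.arccos q'.re)) ^ 2 ≤ ‖q - q'‖ ^ 2 := by
  have hs : Real.sin (Real.arccos q.re) = ‖imVec q‖ := by
    rw [Real.sin_arccos, ← norm_imVec_sq_of_norm_eq_one hq, Real.sqrt_sq (norm_nonneg _)]
  have hs' : Real.sin (Real.arccos q'.re) = ‖imVec q'‖ := by
    rw [Real.sin_arccos, ← norm_imVec_sq_of_norm_eq_one hq', Real.sqrt_sq (norm_nonneg _)]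
  rw [Real.cos_arccos (neg_one_le_re hq) (re_le_one hq), Real.cos_arccos (neg_one_le_re hq') (re_le_one hq'), hs, hs']
  have h1 := norm_sq_eq_re_sq_add_norm_imVec_sq (q - q')
  have imVec_sub : imVec (q - q') = imVec q - imVec q' := by ext i; fin_cases i <;> simp [imVec]
  rw [imVec_sub, Quaternion.re_sub] at h1
  have h2 : |‖imVec q‖ - ‖imVec q'‖| ≤ ‖imVec q - imVec q'‖ := abs_norm_sub_norm_le _ _
  have h3 : (‖imVec q‖ - ‖imVec q'‖) ^ 2 ≤ ‖imVec q - imVec q'‖ ^ 2 := by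
    rw [← sq_abs]; exact pow_le_pow_left₀ (abs_nonneg _) h2 2
  linarith

/-- **The class angle is `π/2`-Lipschitz in the chord**: `|arccos (Re q) − arccos (Re q')| ≤ (π/2)‖q − q'‖` for unit quaternions with
`Re ≥ 0` (so both angles lie in `[0, π/2]`). -/
theorem abs_arccos_sub_arccos_le {q q' : ℍ} (hq : ‖q‖ = 1) (hq' : ‖q'‖ = 1) (h0 : 0 ≤ q.re) (h0' : 0 ≤ q'.re) :
    |Real.arccos q.re - Real.arccos q'.re| ≤ π / 2 * ‖q - q'‖ := by
  set θ := Real.arccos q.re with hθ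
  set θ' := Real.arccos q'.re with hθ'
  have hθ0 : 0 ≤ θ := Real.arccos_nonneg _
  have hθ'0 : 0 ≤ θ' := Real.arccos_nonneg _
  have hθ1 : θ ≤ π / 2 := Real.arccos_le_pi_div_two.2 h0
  have hθ'1 : θ' ≤ π / 2 := Real.arccos_le_pi_div_two.2 h0'
  set a := |θ - θ'| with ha
  have ha0 : 0 ≤ a := abs_nonneg _
  have ha1 : a / 2 ≤ π / 2 := by
    have : a ≤ π / 2 := by rw [ha]; exact abs_sub_le_of_nonneg_of_le hθ0 hθ1 hθ'0 hθ'1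
    linarith [Real.pi_pos]
  -- `(cos θ − cos θ')² + (sin θ − sin θ')² = 2 − 2 cos a = (2 sin(a/2))²`
  have hid : (Real.cos θ - Real.cos θ') ^ 2 + (Real.sin θ - Real.sin θ') ^ 2 = (2 * Real.sin (a / 2)) ^ 2 := by
    rw [← two_sub_two_mul_cos, ha, Real.cos_abs, Real.cos_sub]
    have h1 := Real.sin_sq_add_cos_sq θ
    have h2 := Real.sin_sq_add_cos_sq θ'
    linear_combination h1 + h2
  have hj : 2 / π * (a / 2) ≤ Real.sin (a / 2) := Real.mul_le_sin (by linarith) ha1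
  have hsin0 : 0 ≤ Real.sin (a / 2) := le_trans (by positivity) hj
  have hle : (2 * Real.sin (a / 2)) ^ 2 ≤ ‖q - q'‖ ^ 2 := hid ▸ angle_coords_sq_le hq hq'
  have hle' : 2 * Real.sin (a / 2) ≤ ‖q - q'‖ :=
    (pow_le_pow_iff_left₀ (by positivity) (norm_nonneg _) two_ne_zero).1 hle
  have hπ := Real.pi_pos
  -- `a/π ≤ sin(a/2)` hence `a ≤ (π/2)·(2 sin(a/2)) ≤ (π/2)‖q − q'‖`
  have h3 : a / π ≤ Real.sin (a / 2) := by
    have e : 2 / π * (a / 2) = a / π := by ring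
    rw [← e]; exact hj
  rw [div_le_iff₀ hπ] at h3
  nlinarith

/-- For a unit quaternion with `Re q ≥ 0` and vanishing imaginary part the class angle is `0`. -/
theorem arccos_re_eq_zero_of_imVec_eq_zero {q : ℍ} (hq : ‖q‖ = 1) (h0 : 0 ≤ q.re) (hv : imVec q = 0) :
    Real.arccos q.re = 0 := by
  have h := norm_imVec_sq_of_norm_eq_one hq
  rw [hv, norm_zero] at h
  have hre : q.re = 1 := by nlinarith
  rw [hre, Real.arccos_one]

/-- **The logarithm is 6-Lipschitz on the half-ball**: `‖logVec q − logVec q'‖ ≤ 6‖q − q'‖` for unit quaternions with `Re q, Re q' ≥ 0`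
(angle leg `|θ − θ'| ≤ (π/2)‖q − q'‖`; axis leg `θ'·‖ω − ω'‖ ≤ θ'·2‖v − v'‖/sin θ' ≤ π‖q − q'‖` by Jordan; `3π/2 ≤ 6`). -/
theorem norm_logVec_sub_logVec_le {q q' : ℍ} (hq : ‖q‖ = 1) (hq' : ‖q'‖ = 1) (h0 : 0 ≤ q.re) (h0' : 0 ≤ q'.re) :
    ‖logVec q - logVec q'‖ ≤ 6 * ‖q - q'‖ := by
  have hπ4 := Real.pi_le_four
  have hπ := Real.pi_pos
  have hang := abs_arccos_sub_arccos_le hq hq' h0 h0'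
  have hn := norm_nonneg (q - q')
  by_cases hv' : imVec q' = 0
  · have hθ' := arccos_re_eq_zero_of_imVec_eq_zero hq' h0' hv'
    have hL' : logVec q' = 0 := by
      unfold logVec; rw [if_pos hv', hθ', zero_smul]
    rw [hL', sub_zero, norm_logVec]
    rw [hθ', sub_zero, abs_of_nonneg (Real.arccos_nonneg _)] at hang
    nlinarith
  by_cases hv : imVec q = 0
  · have hθ := arccos_re_eq_zero_of_imVec_eq_zero hq h0 hv
    have hL : logVec q = 0 := by
      unfold logVec; rw [if_pos hv, hθ, zero_smul]
    rw [hL, zero_sub, norm_neg, norm_logVec]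
    rw [hθ, zero_sub, abs_neg, abs_of_nonneg (Real.arccos_nonneg _)] at hang
    nlinarith
  -- both non-central: `logVec = θ • ω`
  set θ := Real.arccos q.re with hθdef
  set θ' := Real.arccos q'.re with hθ'def
  have hθ'0 : 0 ≤ θ' := Real.arccos_nonneg _
  have hθ'1 : θ' ≤ π / 2 := Real.arccos_le_pi_div_two.2 h0'
  have hnv : 0 < ‖imVec q‖ := norm_pos_iff.2 hv
  have hnv' : 0 < ‖imVec q'‖ := norm_pos_iff.2 hv'
  have hs' : Real.sin θ' = ‖imVec q'‖ := by
    rw [hθ'def, Real.sin_arccos, ← norm_imVec_sq_of_norm_eq_one hq', Real.sqrt_sq (norm_nonneg _)]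
  have hL : logVec q = θ • (‖imVec q‖⁻¹ • imVec q) := by
    unfold logVec; rw [if_neg hv, smul_smul, div_eq_mul_inv]
  have hL' : logVec q' = θ' • (‖imVec q'‖⁻¹ • imVec q') := by
    unfold logVec; rw [if_neg hv', smul_smul, div_eq_mul_inv]
  set ω := ‖imVec q‖⁻¹ • imVec q with hωdef
  set ω' := ‖imVec q'‖⁻¹ • imVec q' with hω'def
  have hω : ‖ω‖ = 1 := by rw [hωdef, norm_smul, norm_inv, norm_norm, inv_mul_cancel₀ hnv.ne']
  -- the axis leg
  have hax : ‖ω' - ω‖ ≤ 2 * ‖imVec q' - imVec q‖ / ‖imVec q'‖ := norm_normalize_sub_normalize_le hv' (imVec q)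
  have hvv : ‖imVec q' - imVec q‖ ≤ ‖q - q'‖ := by rw [norm_sub_rev]; exact norm_imVec_sub_le q q'
  have hjordan : θ' ≤ π / 2 * ‖imVec q'‖ := by
    have hj := Real.mul_le_sin hθ'0 hθ'1
    rw [hs'] at hj
    have : θ' = π / 2 * (2 / π * θ') := by field_simp
    rw [this]; exact mul_le_mul_of_nonneg_left hj (by positivity)
  have hax2 : θ' * ‖ω - ω'‖ ≤ π * ‖q - q'‖ := by
    rw [norm_sub_rev]
    calc θ' * ‖ω' - ω‖ ≤ (π / 2 * ‖imVec q'‖) * (2 * ‖imVec q' - imVec q‖ / ‖imVec q'‖) :=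
          mul_le_mul hjordan hax (norm_nonneg _) (by positivity)
      _ = π * ‖imVec q' - imVec q‖ := by field_simp
      _ ≤ π * ‖q - q'‖ := mul_le_mul_of_nonneg_left hvv hπ.le
  rw [hL, hL']
  calc ‖θ • ω - θ' • ω'‖ ≤ ‖θ • ω - θ' • ω‖ + ‖θ' • ω - θ' • ω'‖ := norm_sub_le_norm_sub_add_norm_sub _ _ _
    _ = |θ - θ'| + θ' * ‖ω - ω'‖ := by
        rw [← sub_smul, norm_smul, hω, mul_one, Real.norm_eq_abs, ← smul_sub, norm_smul, Real.norm_of_nonneg hθ'0]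
    _ ≤ π / 2 * ‖q - q'‖ + π * ‖q - q'‖ := add_le_add hang hax2
    _ ≤ 6 * ‖q - q'‖ := by nlinarith

/-- **The principal root is `18/m`-Lipschitz on the half-ball**: for `h, h' ∈ SU(2)` with `Re q_h, Re q_{h'} ≥ 0`,
`‖q(kroot m h) − q(kroot m h')‖ ≤ 18·‖q_h − q_{h'}‖/m`. -/
theorem norm_kroot_sub_kroot_le (m : ℕ) {h h' : SU2} (h0 : 0 ≤ (su2Quat h).re) (h0' : 0 ≤ (su2Quat h').re) :
    ‖su2Quat (kroot m h) - su2Quat (kroot m h')‖ ≤ 18 * ‖su2Quat h - su2Quat h'‖ / m := by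
  unfold kroot
  rw [su2Quat_expPoint, su2Quat_expPoint]
  refine (norm_exp_imQuat_sub_exp_imQuat_le _ _).trans ?_
  rw [← smul_sub, norm_smul, norm_inv, Real.norm_natCast]
  have hL := norm_logVec_sub_logVec_le (norm_su2Quat h) (norm_su2Quat h') h0 h0'
  have hm : 0 ≤ ((m : ℝ))⁻¹ := inv_nonneg.2 (Nat.cast_nonneg m)
  calc 3 * (((m : ℝ))⁻¹ * ‖logVec (su2Quat h) - logVec (su2Quat h')‖)
      = (3 * ‖logVec (su2Quat h) - logVec (su2Quat h')‖) * ((m : ℝ))⁻¹ := by ring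
    _ ≤ (3 * (6 * ‖su2Quat h - su2Quat h'‖)) * ((m : ℝ))⁻¹ := by gcongr
    _ = 18 * ‖su2Quat h - su2Quat h'‖ / m := by rw [div_eq_mul_inv]; ring

/-- `Re q_h ≥ 0` as soon as `‖q_h − 1‖ ≤ 1` (`‖q − 1‖² = 2 − 2 Re q`). -/
theorem re_su2Quat_nonneg_of_norm_sub_one_le {h : SU2} (hh : ‖su2Quat h - 1‖ ≤ 1) : 0 ≤ (su2Quat h).re := by
  have h1 := norm_sub_one_sq (norm_su2Quat h)
  have h2 : ‖su2Quat h - 1‖ ^ 2 ≤ 1 := by nlinarith [norm_nonneg (su2Quat h - 1)]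
  linarith

/-- `‖q(a^t) − q(b^t)‖ ≤ t·‖q_a − q_b‖` (telescoping; the quaternion norm is multiplicative and `‖q_U‖ = 1`). -/
theorem norm_su2Quat_pow_sub_pow_le (a b : SU2) : ∀ t : ℕ, ‖su2Quat (a ^ t) - su2Quat (b ^ t)‖ ≤ t * ‖su2Quat a - su2Quat b‖
  | 0 => by simp [su2Quat_one]
  | t + 1 => by
    rw [pow_succ', pow_succ', su2Quat_mul, su2Quat_mul]
    have key : su2Quat a * su2Quat (a ^ t) - su2Quat b * su2Quat (b ^ t) =
        su2Quat a * (su2Quat (a ^ t) - su2Quat (b ^ t)) + (su2Quat a - su2Quat b) * su2Quat (b ^ t) := by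
      rw [mul_sub, sub_mul]; abel
    rw [key]
    calc ‖su2Quat a * (su2Quat (a ^ t) - su2Quat (b ^ t)) + (su2Quat a - su2Quat b) * su2Quat (b ^ t)‖
        ≤ ‖su2Quat a * (su2Quat (a ^ t) - su2Quat (b ^ t))‖ + ‖(su2Quat a - su2Quat b) * su2Quat (b ^ t)‖ := norm_add_le _ _
      _ = ‖su2Quat (a ^ t) - su2Quat (b ^ t)‖ + ‖su2Quat a - su2Quat b‖ := by
          rw [norm_mul, norm_mul, norm_su2Quat, norm_su2Quat, one_mul, mul_one]
      _ ≤ t * ‖su2Quat a - su2Quat b‖ + ‖su2Quat a - su2Quat b‖ := by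
          gcongr; exact norm_su2Quat_pow_sub_pow_le a b t
      _ = ((t + 1 : ℕ) : ℝ) * ‖su2Quat a - su2Quat b‖ := by push_cast; ring

/-- **Sandwich bound**: `‖A V B⋆ − 1‖ ≤ ‖V − 1‖ + ‖A − B‖` for unit `A, B` (any `V`). -/
theorem norm_mul_mul_star_sub_one_le {A B : ℍ} (hA : ‖A‖ = 1) (hB : ‖B‖ = 1) (V : ℍ) :
    ‖A * V * star B - 1‖ ≤ ‖V - 1‖ + ‖A - B‖ := by
  have hBB : B * star B = 1 := by
    rw [Quaternion.self_mul_star, Quaternion.normSq_eq_norm_mul_self, hB, mul_one, Quaternion.coe_one]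
  have hsplit : A * V * star B - 1 = A * (V - 1) * star B + (A - B) * star B := by
    rw [mul_sub, sub_mul, sub_mul, mul_one, hBB]; abel
  rw [hsplit]
  calc ‖A * (V - 1) * star B + (A - B) * star B‖ ≤ ‖A * (V - 1) * star B‖ + ‖(A - B) * star B‖ := norm_add_le _ _
    _ = ‖V - 1‖ + ‖A - B‖ := by
        rw [norm_mul, norm_mul, norm_mul, Quaternion.norm_star, hA, hB, one_mul, mul_one, mul_one]

/-- The quaternion length `ℓ(U) = ‖su2Quat U − 1‖`. -/
def ellq (U : SU2) : ℝ := ‖su2Quat U - 1‖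

/-- `ℓ(1) = 0`. -/
theorem ellq_one : ellq 1 = 0 := by rw [ellq, su2Quat_one, sub_self, norm_zero]

/-- `0 ≤ ℓ`. -/
theorem ellq_nonneg (U : SU2) : 0 ≤ ellq U := norm_nonneg _

/-- `ℓ(xy) ≤ ℓ(x) + ℓ(y)`. -/
theorem ellq_mul_le (x y : SU2) : ellq (x * y) ≤ ellq x + ellq y := by
  unfold ellq
  rw [su2Quat_mul]
  have h : su2Quat x * su2Quat y - 1 = su2Quat x * (su2Quat y - 1) + (su2Quat x - 1) := by rw [mul_sub, mul_one]; abel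
  rw [h]
  calc ‖su2Quat x * (su2Quat y - 1) + (su2Quat x - 1)‖ ≤ ‖su2Quat x * (su2Quat y - 1)‖ + ‖su2Quat x - 1‖ := norm_add_le _ _
    _ = ‖su2Quat y - 1‖ + ‖su2Quat x - 1‖ := by rw [norm_mul, norm_su2Quat, one_mul]
    _ = ‖su2Quat x - 1‖ + ‖su2Quat y - 1‖ := add_comm _ _

/-- `ℓ(x⁻¹) = ℓ(x)`. -/
theorem ellq_inv (x : SU2) : ellq x⁻¹ = ellq x := by
  unfold ellq; rw [su2Quat_inv, ← star_one ℍ, ← star_sub, Quaternion.norm_star, star_one]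

/-- `ℓ` is a class function: `ℓ(g x g⁻¹) = ℓ(x)`. -/
theorem ellq_conj (g x : SU2) : ellq (g * x * g⁻¹) = ellq x := by
  unfold ellq
  rw [LandauBall.su2Quat_mul_mul_inv]
  have hgg : su2Quat g * star (su2Quat g) = 1 := by
    rw [Quaternion.self_mul_star, Quaternion.normSq_eq_norm_mul_self, norm_su2Quat, mul_one, Quaternion.coe_one]
  have h : su2Quat g * su2Quat x * star (su2Quat g) - 1 = su2Quat g * (su2Quat x - 1) * star (su2Quat g) := by
    rw [mul_sub, sub_mul, mul_one, hgg]
  rw [h, norm_mul, norm_mul, Quaternion.norm_star, norm_su2Quat, one_mul, mul_one]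

/-- Two-point distances are lengths of quotients: `‖q_a − q_c‖ = ℓ(a c⁻¹)`. -/
theorem norm_su2Quat_sub_eq_ellq (a c : SU2) : ‖su2Quat a - su2Quat c‖ = ellq (a * c⁻¹) := by
  unfold ellq
  rw [su2Quat_mul, su2Quat_inv]
  have hcc : star (su2Quat c) * su2Quat c = 1 := by
    rw [Quaternion.star_mul_self, Quaternion.normSq_eq_norm_mul_self, norm_su2Quat, mul_one, Quaternion.coe_one]
  have h : su2Quat a - su2Quat c = (su2Quat a * star (su2Quat c) - 1) * su2Quat c := by
    rw [sub_mul, one_mul, mul_assoc, hcc, mul_one]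
  rw [h, norm_mul, norm_su2Quat, mul_one]

/-- `ℓ² = 2 − Re tr`: the squared length is the line's link defect, `ℓ(U_e)² = linkDefect U e`. -/
theorem ellq_sq_eq_linkDefect (U : Literature.MathematicalPhysics.QuantumLattice.LGConfig 4 SU2)
    (e : Literature.MathematicalPhysics.QuantumLattice.ZdEdge 4) : ellq (U e) ^ 2 = linkDefect U e := by
  rw [ellq, LandauBall.linkDefect_eq_norm_sq]

/-- `ℓ = opDist1 ∘ ρ_fund`: the quaternion length IS the operator-norm length of the tree's forest ladder (both are `√(2 − Re tr U)`). -/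
theorem ellq_eq_opDist1 (U : SU2) : ellq U = opDist1 (fundamentalRep (Fin 2) U) := by
  have h1 : ellq U ^ 2 = 2 - ((U : Matrix (Fin 2) (Fin 2) ℂ).trace).re := by
    rw [ellq, norm_sub_rev]; exact (su2Deficit_eq_norm_sub_sq U).symm
  have h2 := opDist1_fundamentalRep_sq U
  exact (pow_left_inj₀ (ellq_nonneg U) (opDist1_nonneg _) two_ne_zero).1 (h1.trans h2.symm)

/-- `ℓ(a^t) ≤ t·ℓ(a)`. -/
theorem ellq_pow_le (a : SU2) (t : ℕ) : ellq (a ^ t) ≤ t * ellq a := by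
  have h := norm_su2Quat_pow_sub_pow_le a 1 t
  rwa [one_pow, su2Quat_one] at h

end Summit.QuantumFields.YangMills.Theorems.AllWindowsColdBoxBoxHighLine.UniformGauge

end
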